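import Literature.Computability.AlgebraicComplexity.IMMWeaklySkew
import Literature.Computability.AlgebraicComplexity.BLMW11WeaklySkewToSkewProofs
import Literature.Computability.AlgebraicComplexity.AutomatonIMM
import Literature.Computability.AlgebraicComplexity.BLMW11ApproximationProjections
import HarnessLib

/-!
# `(IMM_{n,n})` is `VBP`-complete — the hardness half of Bürgisser 2024, Cor. 2.24 — PROOFS

Topic `Computability/AlgebraicComplexity`. Cell `val-lit`, row Bur2024-A (P. Bürgisser,
*Completeness classes in algebraic complexity theory*, arXiv:2406.06217, 2024; held text
`paper:arxiv-2406.06217`, p0009 L83–L95):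

> Consider the iterated matrix multiplication family defined by `IMM_{n,d} := tr(A_1 ⋯ A_d)`,
> where the `A_i` are `n × n` matrices with independent indeterminate entries. We already noted
> in Remark 2.8 that `IMM ∈ VBP`. […] this does not affect the completeness result below, which
> is obtained by a modification of the proof of Proposition 2.23.
>
> **Corollary 2.24.** The iterated matrix multiplication family `(IMM_{n,n})` is `VBP`-complete
> over any field.

The tree's `immPoly n d k = tr(X^{(1)} ⋯ X^{(d)})` (`StandardFamilies.lean`) is exactly the
printed trace form, `VBP = VP_ws` is `IsVPwsFamily` (weakly-skew circuits of p-bounded size,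
`BLMW11KroneckerApproximation.lean`; Bürgisser 2024 Def. 2.9), and completeness is with respect
to p-projections (`IsPProjection`, Def. 2.15–2.16). The membership half `IMM ∈ VBP` is
`isVPwsFamily_immPoly` (`IMMWeaklySkew.lean`, for `n ↦ IMM_{n^c,n}`); this file proves the
HARDNESS half and assembles the corollary, over every commutative ring:

* `HI16Skew.isProjection_immPoly_of_isSkew` — a fan-in-two skew circuit with `s` gates computes
  a PROJECTION of `immPoly (6s+4) (6s+4) k` (the analogue of Prop. 2.23 / Malod–Portier 2008
  Lemma 6 with `IMM` in place of `DET`);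
* `isPProjection_immPoly_of_isVPwsFamily` — every `VP_ws` family (any variable types) is a
  p-projection of `n ↦ immPoly n n k`; `isPProjection_detPoly_of_isVPwsFamily` — the same for
  `n ↦ det_n` (Thm. 2.20 "`(DET_n)` is `VBP`-complete over any field", hypothesis-free and for
  arbitrary variable types; the tree's `HI16Skew.isPProjection_detPoly_of_skew_le_ws` is the
  `Fin (v n)`-indexed form conditional on "weakly skew ⇒ skew", since discharged by
  `ArithCircuit.skewComplexity_le_four_mul_wsComplexity`);
* `isVPwsFamily_immPoly_sq` (`n ↦ IMM_{n,n} ∈ VP_ws`), **`Bur24_cor_2_24`** (membership ∧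
  hardness), and the mutual p-projections `isPProjection_detPoly_immPoly`,
  `isPProjection_immPoly_detPoly` of the two `VBP`-complete families;
* the characterisations **`isVPwsFamily_iff_isPProjection_detPoly`** and
  **`isVPwsFamily_iff_isPProjection_immPoly`**: a family is in `VBP = VP_ws` iff it is a
  p-projection of `(DET_n)`, iff it is a p-projection of `(IMM_{n,n})` (completeness together
  with the closure of `VP_ws` under p-projections, `IsVPwsFamily.of_isPProjection`).

## Proof (the "modification of the proof of Proposition 2.23")

Prop. 2.23 turns a (weakly) skew circuit into an acyclic edge-labelled digraph whose `s–t` path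
sum is the computed polynomial and reads that path sum as a determinant. The tree already holds
the digraph: for a fan-in-two skew circuit `P`, `HI16Skew.todaE P` (Malod–Portier 2008, Lemma 5,
in `HI16SkewCircuitsProofs.lean`) is its adjacency matrix on `3s+2` vertices `TV s`, with entries
variables and constants, and `HI16Skew.eval_eq_W_vT : P.eval = pathValue (todaE P) s t`, where
`pathValue E s t = ∑_{ℓ < |V|} (−1)^ℓ (E^{ℓ+1}) s t` is Hüttenhain–Ikenmeyer's signed path sum
(`HI16BinaryDC.lean`). Instead of closing the paths up into cycle covers we LAYER them by time:
the block matrix `U = [[E, 1], [0, −1]]` on `V ⊕ V` satisfies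
`U^m = [[E^m, S_m], [0, (−1)^m]]` with `S_m = ∑_{i<m} (−1)^{m+i+1} E^i`
(`fromBlocks_stepMatrix_pow`), so `(U^{|V|+1})_{(s,1),(t,2)} = (−1)^{|V|+1} · pathValue E s t`
(`stepMatrix_pow_apply_inl_inr`), and therefore
`pathValue E s t = tr(C · U^{|V|+1} · 1 ⋯ 1)` with the constant matrix
`C = (−1)^{|V|+1} e_{(t,2)} e_{(s,1)}ᵀ` — a trace of a product of `2|V|` matrices of size
`2|V|` whose entries are variables or constants, i.e. a projection of `IMM_{2|V|, 2|V|}`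
(`isProjection_pathValue_immPoly`; the `IMM` variables are routed through a bijection
`V ⊕ V ≃ Fin (2|V|)` and `LayeredAutomaton.aeval_immPoly_eq_trace`). For families, a
size-optimal well-formed skew circuit (`HI16Skew.skewComplexity_attained`) has
`s ≤ L_skew ≤ 4 L_ws` gates (`ArithCircuit.skewComplexity_le_four_mul_wsComplexity`), so
`6s + 4` is p-bounded.

Deviations, disclosed: (i) the survey works over a field; everything here holds over every
commutative ring. (ii) The matrix format is `6s+4` in the number `s` of gates of a SKEW circuit
(print: a projection of `IMM` of format linear in the weakly-skew size; our constants go through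
the tree's `L_skew ≤ 4 L_ws` and are not the printed ones). Theorems only: no definitions, no
named facts, no `sorry` (D-0026). Honest framing: textbook completeness bookkeeping inside
`VBP`; `VP ≠ VNP` is NOT proved and nothing here bears on it.

## References

* [Burgisser2024Completeness] P. Bürgisser, *Completeness classes in algebraic complexity
  theory*, arXiv:2406.06217 (2024), §2.5, Thm. 2.20, Rem. 2.22, Prop. 2.23, Cor. 2.24
  (held `paper:arxiv-2406.06217`, p0008 L78 – p0009 L95).
* [MalodPortier2008] G. Malod, N. Portier, *Characterizing Valiant's algebraic complexity
  classes*, J. Complexity 24 (2008) 16–38, Lemma 5 (circuit → digraph), Lemma 6 (universality).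
* [HuttenhainIkenmeyer2016] J. Hüttenhain, C. Ikenmeyer, *Binary determinantal complexity*,
  Linear Algebra Appl. 504 (2016), §2 (signed path value).
-/

noncomputable section

open MvPolynomial Finset Matrix

namespace Literature.Computability.AlgebraicComplexity

universe u v w

/-! ## §1. The time-layering block matrix `U = [[E, 1], [0, −1]]` and its powers -/

section StepMatrix

variable {R : Type u} [CommRing R] {V : Type v} [Fintype V] [DecidableEq V]

/-- **Powers of the step matrix.** For a square matrix `E` (the adjacency matrix of an
edge-labelled digraph), the block matrix `U = [[E, 1], [0, −1]]` on `V ⊕ V` has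
`U^m = [[E^m, S_m], [0, (−1)^m]]` with `S_m = ∑_{i<m} (−1)^{m+i+1} E^i` — the upper-right block
accumulates the alternating sum of the walk matrices `E^i` (the time-layering of the digraph used
for Cor. 2.24: "stay" loops `1`, one copy of `E` per step, signs carried by the `−1` block).
[cite: Burgisser2024Completeness, Cor. 2.24 (proof)] -/
theorem fromBlocks_stepMatrix_pow (E : Matrix V V R) (m : ℕ) :
    (Matrix.fromBlocks E 1 0 (-1) : Matrix (V ⊕ V) (V ⊕ V) R) ^ m =
      Matrix.fromBlocks (E ^ m) (∑ i ∈ range m, ((-1 : R) ^ (m + i + 1)) • E ^ i) 0 ((-1) ^ m) := by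
  induction m with
  | zero =>
    rw [pow_zero, pow_zero, pow_zero, Finset.sum_range_zero]
    exact Matrix.fromBlocks_one.symm
  | succ m ih =>
    rw [pow_succ, ih, Matrix.fromBlocks_multiply]
    have h1 : ∀ i : ℕ, ((-1 : R) ^ (m + 1 + i + 1)) • E ^ i = -(((-1 : R) ^ (m + i + 1)) • E ^ i) := by
      intro i
      rw [show m + 1 + i + 1 = (m + i + 1) + 1 by ring, pow_succ, mul_neg_one, neg_smul]
    have h2 : ((-1 : R) ^ (m + 1 + m + 1)) = 1 := by
      rw [show m + 1 + m + 1 = 2 * (m + 1) by ring, pow_mul, neg_one_sq, one_pow]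
    congr 1
    · rw [Matrix.mul_zero, add_zero, pow_succ]
    · rw [Matrix.mul_one, Matrix.mul_neg, Matrix.mul_one, Finset.sum_range_succ, h2, one_smul]
      simp_rw [h1]
      rw [Finset.sum_neg_distrib]
      abel
    · rw [Matrix.zero_mul, Matrix.mul_zero, add_zero]
    · rw [Matrix.zero_mul, zero_add, pow_succ]

/-- **The upper-right block at a pair of distinct vertices is the signed path value**:
`(U^{|V|+1})_{(s,1),(t,2)} = (−1)^{|V|+1} · pathValue E s t` for `s ≠ t`
(`pathValue E s t = ∑_{ℓ<|V|} (−1)^ℓ (E^{ℓ+1}) s t`, Hüttenhain–Ikenmeyer's signed path sum; the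
`i = 0` term of `S_{|V|+1}` vanishes off the diagonal).
[cite: Burgisser2024Completeness, Cor. 2.24 (proof)] -/
theorem stepMatrix_pow_apply_inl_inr (E : Matrix V V R) {s t : V} (hst : s ≠ t) :
    ((Matrix.fromBlocks E 1 0 (-1) : Matrix (V ⊕ V) (V ⊕ V) R) ^ (Fintype.card V + 1))
        (Sum.inl s) (Sum.inr t) =
      (-1 : R) ^ (Fintype.card V + 1) * pathValue E s t := by
  rw [fromBlocks_stepMatrix_pow, Matrix.fromBlocks_apply₁₂, Matrix.sum_apply,
    Finset.sum_range_succ', pathValue, Finset.mul_sum]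
  simp only [Matrix.smul_apply, smul_eq_mul, pow_zero, Matrix.one_apply_ne hst, mul_zero,
    add_zero]
  refine Finset.sum_congr rfl fun i _ => ?_
  rw [← mul_assoc, ← pow_add,
    show Fintype.card V + 1 + (i + 1) + 1 = (Fintype.card V + 1 + i) + 2 by ring, pow_add,
    neg_one_sq, mul_one]

/-- **The layered product**: with `a ≤ M`, the `M + 1` factors
"`C`, then `a` copies of `U`, then unit matrices" multiply to `C · U^a`.
[cite: Burgisser2024Completeness, Cor. 2.24 (proof)] -/
theorem prod_map_layerFactors {W : Type w} [Fintype W] [DecidableEq W] (C U : Matrix W W R)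
    {M a : ℕ} (ha : a ≤ M) :
    ((List.finRange (M + 1)).map fun l : Fin (M + 1) =>
        if (l : ℕ) = 0 then C else if (l : ℕ) ≤ a then U else 1).prod = C * U ^ a := by
  -- the tail: `a` copies of `U` followed by units
  have tail : ∀ (M a : ℕ), ((List.finRange M).map fun l : Fin M =>
      if (l : ℕ) < a then U else (1 : Matrix W W R)).prod = U ^ (min a M) := by
    intro M
    induction M with
    | zero => intro a; simp
    | succ M ih =>
      intro a
      rw [List.finRange_succ, List.map_cons, List.prod_cons, List.map_map]
      cases a with
      | zero =>
        simp only [Fin.val_zero, lt_self_iff_false, if_false, one_mul, Nat.zero_min, pow_zero]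
        have : ((fun l : Fin (M + 1) => if (l : ℕ) < 0 then U else (1 : Matrix W W R)) ∘ Fin.succ) =
            fun l : Fin M => if (l : ℕ) < 0 then U else 1 := by
          funext l; simp
        rw [this, ih 0, Nat.zero_min, pow_zero]
      | succ a =>
        simp only [Fin.val_zero, Nat.zero_lt_succ, if_true]
        have : ((fun l : Fin (M + 1) => if (l : ℕ) < a + 1 then U else (1 : Matrix W W R)) ∘ Fin.succ) =
            fun l : Fin M => if (l : ℕ) < a then U else 1 := by
          funext l; simp [Fin.val_succ]
        have hmin : min (a + 1) (M + 1) = min a M + 1 := by omega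
        rw [this, ih a, hmin, pow_succ']
  rw [List.finRange_succ, List.map_cons, List.prod_cons, List.map_map]
  simp only [Fin.val_zero, if_true]
  have : ((fun l : Fin (M + 1) => if (l : ℕ) = 0 then C else if (l : ℕ) ≤ a then U else (1 : Matrix W W R)) ∘
      Fin.succ) = fun l : Fin M => if (l : ℕ) < a then U else 1 := by
    funext l
    simp only [Function.comp_apply, Fin.val_succ, Nat.succ_ne_zero, if_false]
    rfl
  rw [this, tail M a, min_eq_left ha]

end StepMatrix

/-! ## §2. Path values of digraphs with variable/constant labels are projections of `IMM` -/

section PathValue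

variable {k : Type u} [CommRing k] {τ : Type w} {V : Type v} [Fintype V] [DecidableEq V]

/-- The trace is invariant under re-indexing rows and columns by one bijection. [folklore] -/
private theorem trace_reindex_self {W W' : Type*} [Fintype W] [Fintype W'] {S : Type*}
    [AddCommMonoid S] (e : W ≃ W') (A : Matrix W W S) :
    Matrix.trace (Matrix.reindex e e A) = Matrix.trace A := by
  simp only [Matrix.trace, Matrix.reindex_apply, Matrix.diag_apply, Matrix.submatrix_apply]
  exact e.symm.sum_comp (fun i => A i i)

/-- **A signed path value is a projection of `IMM`.** Let `E` be a square matrix over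
`k[X_τ]` on a finite vertex type `V` all of whose entries are variables or constants (an
edge-labelled digraph), `s ≠ t`, and `M + 1 = 2|V|` with `|V| + 1 ≤ M`. Then
`pathValue E s t` is a projection of `immPoly (M+1) (M+1) k = tr(X^{(1)} ⋯ X^{(M+1)})`: route
the `IMM` variables through a bijection `Fin (M+1) ≃ V ⊕ V` onto the factors
`C = (−1)^{|V|+1} e_{(t,2)} e_{(s,1)}ᵀ`, `|V| + 1` copies of `U = [[E, 1], [0, −1]]`, and unit
matrices; the trace of the product is `(−1)^{|V|+1} (U^{|V|+1})_{(s,1),(t,2)} = pathValue E s t`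
(`stepMatrix_pow_apply_inl_inr`). This is the `IMM` reading of an algebraic branching program
(Bürgisser 2024, Cor. 2.24: "obtained by a modification of the proof of Proposition 2.23").
[cite: Burgisser2024Completeness, Cor. 2.24 (proof)] -/
theorem isProjection_pathValue_immPoly (E : Matrix V V (MvPolynomial τ k))
    (hE : ∀ u v, (∃ x, E u v = X x) ∨ ∃ c, E u v = C c) {s t : V} (hst : s ≠ t) {M : ℕ}
    (hM : Fintype.card V + 1 ≤ M) (hcard : Fintype.card (V ⊕ V) = M + 1) :
    IsProjection (pathValue E s t) (immPoly (M + 1) (M + 1) k) := by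
  classical
  -- the data
  set n : ℕ := Fintype.card V with hn
  let e : (V ⊕ V) ≃ Fin (M + 1) := Fintype.equivFinOfCardEq hcard
  let U : Matrix (V ⊕ V) (V ⊕ V) (MvPolynomial τ k) := Matrix.fromBlocks E 1 0 (-1)
  let C₀ : Matrix (V ⊕ V) (V ⊕ V) (MvPolynomial τ k) :=
    Matrix.single (Sum.inr t) (Sum.inl s) (C ((-1 : k) ^ (n + 1)))
  let A : Fin (M + 1) → Matrix (V ⊕ V) (V ⊕ V) (MvPolynomial τ k) := fun l =>
    if (l : ℕ) = 0 then C₀ else if (l : ℕ) ≤ n + 1 then U else 1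
  refine ⟨fun v => A v.1 (e.symm v.2.1) (e.symm v.2.2), ?_, ?_⟩
  · -- every substituted entry is a variable or a constant
    have h0 : (∃ x, (0 : MvPolynomial τ k) = X x) ∨ ∃ c, (0 : MvPolynomial τ k) = C c :=
      Or.inr ⟨0, (map_zero C).symm⟩
    have hone : ∀ u v : V, (∃ x, (1 : Matrix V V (MvPolynomial τ k)) u v = X x) ∨
        ∃ c, (1 : Matrix V V (MvPolynomial τ k)) u v = C c := by
      intro u v
      by_cases huv : u = v
      · subst huv; exact Or.inr ⟨1, by rw [Matrix.one_apply_eq, map_one]⟩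
      · rw [Matrix.one_apply_ne huv]; exact h0
    have hone' : ∀ u v : V ⊕ V, (∃ x, (1 : Matrix (V ⊕ V) (V ⊕ V) (MvPolynomial τ k)) u v = X x) ∨
        ∃ c, (1 : Matrix (V ⊕ V) (V ⊕ V) (MvPolynomial τ k)) u v = C c := by
      intro u v
      by_cases huv : u = v
      · subst huv; exact Or.inr ⟨1, by rw [Matrix.one_apply_eq, map_one]⟩
      · rw [Matrix.one_apply_ne huv]; exact h0
    have hU : ∀ u v : V ⊕ V, (∃ x, U u v = X x) ∨ ∃ c, U u v = C c := by
      rintro (u | u) (v | v)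
      · simp only [U, Matrix.fromBlocks_apply₁₁]; exact hE u v
      · simp only [U, Matrix.fromBlocks_apply₁₂]; exact hone u v
      · simp only [U, Matrix.fromBlocks_apply₂₁, Matrix.zero_apply]; exact h0
      · simp only [U, Matrix.fromBlocks_apply₂₂, Matrix.neg_apply]
        rcases hone u v with ⟨x, hx⟩ | ⟨c, hc⟩
        · -- impossible shape, but harmless: `1 u v` is never a variable; argue by cases instead
          by_cases huv : u = v
          · subst huv; exact Or.inr ⟨-1, by rw [Matrix.one_apply_eq, map_neg, map_one]⟩
          · rw [Matrix.one_apply_ne huv, neg_zero]; exact h0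
        · exact Or.inr ⟨-c, by rw [hc, map_neg]⟩
    have hC₀ : ∀ u v : V ⊕ V, (∃ x, C₀ u v = X x) ∨ ∃ c, C₀ u v = C c := by
      intro u v
      simp only [C₀, Matrix.single_apply]
      split_ifs
      · exact Or.inr ⟨_, rfl⟩
      · exact h0
    rintro ⟨l, i, j⟩
    dsimp only [A]
    split_ifs
    · exact hC₀ _ _
    · exact hU _ _
    · exact hone' _ _
  · -- the value: `tr (C₀ · U^{n+1}) = pathValue E s t`
    rw [LayeredAutomaton.aeval_immPoly_eq_trace]
    have hA : (fun l : Fin (M + 1) => (Matrix.of fun i j => A l (e.symm i) (e.symm j))) =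
        ⇑(Matrix.reindexRingEquiv (MvPolynomial τ k) e) ∘ A := by
      funext l
      ext i j
      simp [Matrix.reindex_apply, Matrix.submatrix_apply]
    rw [hA, ← List.map_map, ← map_list_prod, Matrix.coe_reindexRingEquiv, trace_reindex_self,
      prod_map_layerFactors C₀ U (le_trans (Nat.le_refl _) hM), Matrix.trace_single_mul,
      stepMatrix_pow_apply_inl_inr E hst, smul_eq_mul, ← mul_assoc, ← hn, map_pow, map_neg,
      map_one, ← pow_add, ← two_mul, pow_mul, neg_one_sq, one_pow, one_mul]

end PathValue

/-! ## §3. Skew circuits compute projections of `IMM` (the `IMM` analogue of Prop. 2.23) -/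

namespace HI16Skew

open ArithCircuit

variable {k : Type u} [CommRing k] {τ : Type v} (P : ArithCircuit k τ)

/-- Operand labels of the circuit digraph are variables or constants (`X x`, `C c`, `1`, `0`).
[cite: MalodPortier2008, Lemma 5] -/
theorem opLab_isVarOrConst (i : ℕ) (u : Operand k τ) :
    (∃ x, opLab P i u = X x) ∨ ∃ c, opLab P i u = C c := by
  cases u with
  | var x => exact Or.inl ⟨x, rfl⟩
  | const c => exact Or.inr ⟨c, rfl⟩
  | gate j =>
    simp only [opLab]
    split_ifs
    · exact Or.inr ⟨1, (map_one C).symm⟩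
    · exact Or.inr ⟨0, (map_zero C).symm⟩

/-- First-arc labels are variables or constants. [cite: MalodPortier2008, Lemma 5] -/
theorem inLab_isVarOrConst (i : Fin P.size) (e : Fin 2) :
    (∃ x, inLab P i e = X x) ∨ ∃ c, inLab P i e = C c := by
  unfold inLab
  cases slot P i e with
  | none => exact Or.inr ⟨0, (map_zero C).symm⟩
  | some d => exact opLab_isVarOrConst P i d.1

/-- Second-arc labels are variables or constants. [cite: MalodPortier2008, Lemma 5] -/
theorem outLab_isVarOrConst (i : Fin P.size) (e : Fin 2) :
    (∃ x, outLab P i e = X x) ∨ ∃ c, outLab P i e = C c := by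
  unfold outLab
  cases slot P i e with
  | none => exact Or.inr ⟨0, (map_zero C).symm⟩
  | some d => exact opLab_isVarOrConst P i d.2

/-- **The entries of the circuit digraph `todaE P` are variables or constants** (so that any
matrix read-out of its path values is a Valiant projection). [cite: MalodPortier2008, Lemma 5] -/
theorem todaE_isVarOrConst (u v : TV P.size) :
    (∃ x, todaE P u v = X x) ∨ ∃ c, todaE P u v = C c := by
  have h0 : (∃ x, (0 : MvPolynomial τ k) = X x) ∨ ∃ c, (0 : MvPolynomial τ k) = C c :=
    Or.inr ⟨0, (map_zero C).symm⟩
  rcases v with (x | x) | (i | ⟨i, e⟩)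
  · exact h0
  · have hv : todaE P u (Sum.inl (Sum.inr x)) =
        if u = opSrc P P.size P.output then opLab P P.size P.output else 0 := rfl
    rw [hv]
    split_ifs
    · exact opLab_isVarOrConst P _ _
    · exact h0
  · rcases u with (y | y) | (j | ⟨i', e'⟩)
    · exact h0
    · exact h0
    · exact h0
    · have hv : todaE P (Sum.inr (Sum.inr (i', e'))) (Sum.inr (Sum.inl i)) =
          if i' = i then outLab P i e' else 0 := rfl
      rw [hv]
      split_ifs
      · exact outLab_isVarOrConst P _ _
      · exact h0
  · have hv : todaE P u (Sum.inr (Sum.inr (i, e))) =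
        if u = inSrc P i e then inLab P i e else 0 := rfl
    rw [hv]
    split_ifs
    · exact inLab_isVarOrConst P _ _
    · exact h0

/-- `|TV s| = 3s + 2`. [folklore] -/
private theorem card_TV' (s : ℕ) : Fintype.card (TV s) = 3 * s + 2 := by
  simp only [Fintype.card_sum, Fintype.card_unit, Fintype.card_prod, Fintype.card_fin]
  ring

/-- **Universality of `IMM` for skew circuits** (Bürgisser 2024, Cor. 2.24, "by a modification
of the proof of Proposition 2.23"; the `IMM` analogue of Malod–Portier 2008, Lemma 6): a
fan-in-two skew circuit with `s` gates computes a projection of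
`IMM_{6s+4, 6s+4} = immPoly (6s+4) (6s+4) k`, over every commutative ring — its value is the
signed `s–t` path value of the circuit digraph `todaE P` on `3s+2` vertices
(`eval_eq_W_vT`), which `isProjection_pathValue_immPoly` reads as a trace of `6s+4` matrices of
format `6s+4` with variable/constant entries.
[cite: Burgisser2024Completeness, Cor. 2.24] [cite: MalodPortier2008, Lemma 6] -/
theorem isProjection_immPoly_of_isSkew (h2 : P.IsFanInTwo) (hsk : P.IsSkew) :
    IsProjection P.eval (immPoly (6 * P.size + 4) (6 * P.size + 4) k) := by
  classical
  rw [eval_eq_W_vT P h2 hsk]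
  have hst : (vS : TV P.size) ≠ vT := by simp
  exact isProjection_pathValue_immPoly (todaE P) (todaE_isVarOrConst P) hst (M := 6 * P.size + 3)
    (by rw [card_TV']; omega) (by rw [Fintype.card_sum, card_TV']; ring)

end HI16Skew

/-! ## §4. `VBP`-completeness of `(IMM_{n,n})` and of `(DET_n)` for families -/

section Families

variable {k : Type u} [CommRing k]

/-- **Every `VBP = VP_ws` family is a p-projection of `(IMM_{n,n})`** — the hardness half of
Bürgisser 2024, Cor. 2.24, over every commutative ring and for families in arbitrary variable
types: a size-optimal well-formed fan-in-two skew circuit for `f_n`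
(`HI16Skew.skewComplexity_attained`) has `s_n = L_skew(f_n) ≤ 4 L_ws(f_n)` gates
(`ArithCircuit.skewComplexity_le_four_mul_wsComplexity`), and computes a projection of
`IMM_{6 s_n + 4, 6 s_n + 4}` (`HI16Skew.isProjection_immPoly_of_isSkew`); `6 s_n + 4` is
p-bounded. [cite: Burgisser2024Completeness, Cor. 2.24] -/
theorem isPProjection_immPoly_of_isVPwsFamily {σ : ℕ → Type v} {f : ∀ n, MvPolynomial (σ n) k}
    (hf : IsVPwsFamily f) : IsPProjection f (fun n => immPoly n n k) := by
  classical
  choose P _ h2 hsk hcomp hsize using fun n => HI16Skew.skewComplexity_attained (f n)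
  refine ⟨fun n => 6 * (P n).size + 4, ?_, fun n => ?_⟩
  · obtain ⟨d, hd⟩ := hf
    have hpoly : IsPBounded fun n => 6 * (4 * (n ^ d + d)) + 4 :=
      IsPBounded.add_holds (IsPBounded.mul_holds (IsPBounded.const 6)
        (IsPBounded.mul_holds (IsPBounded.const 4) ⟨d, fun n => le_rfl⟩)) (IsPBounded.const 4)
    refine hpoly.mono fun n => ?_
    have h1 : (P n).size ≤ 4 * (n ^ d + d) :=
      (hsize n).le.trans ((ArithCircuit.skewComplexity_le_four_mul_wsComplexity _).trans
        (Nat.mul_le_mul_left 4 (hd n)))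
    exact Nat.add_le_add_right (Nat.mul_le_mul_left 6 h1) 4
  · have h := HI16Skew.isProjection_immPoly_of_isSkew (P n) (h2 n) (hsk n)
    have he : (P n).eval = f n := hcomp n
    rwa [he] at h

/-- **Every `VBP = VP_ws` family is a p-projection of `(DET_n)`** — Bürgisser 2024, Thm. 2.20
("The sequence `(DET_n)` is `VBP`-complete over any field"; [Toda 1992, Malod–Portier 2008]),
hardness half, over every commutative ring and for families in arbitrary variable types,
hypothesis-free: the tree's `HI16Skew.isPProjection_detPoly_of_skew_le_ws` (conditional on
"weakly skew ⇒ skew with a linear factor", `Fin (v n)`-indexed) fed with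
`ArithCircuit.skewComplexity_le_four_mul_wsComplexity`, re-run for arbitrary `σ n` through
`HI16Skew.isProjection_detPoly_of_isSkew` (`f_n` is a projection of `det_{3 s_n + 1}`).
[cite: Burgisser2024Completeness, Thm. 2.20] -/
theorem isPProjection_detPoly_of_isVPwsFamily {σ : ℕ → Type v} {f : ∀ n, MvPolynomial (σ n) k}
    (hf : IsVPwsFamily f) : IsPProjection f (fun n => detPoly (Fin n) k) := by
  classical
  choose P _ h2 hsk hcomp hsize using fun n => HI16Skew.skewComplexity_attained (f n)
  refine ⟨fun n => 3 * (P n).size + 1, ?_, fun n => ?_⟩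
  · obtain ⟨d, hd⟩ := hf
    have hpoly : IsPBounded fun n => 3 * (4 * (n ^ d + d)) + 1 :=
      IsPBounded.add_holds (IsPBounded.mul_holds (IsPBounded.const 3)
        (IsPBounded.mul_holds (IsPBounded.const 4) ⟨d, fun n => le_rfl⟩)) (IsPBounded.const 1)
    refine hpoly.mono fun n => ?_
    have h1 : (P n).size ≤ 4 * (n ^ d + d) :=
      (hsize n).le.trans ((ArithCircuit.skewComplexity_le_four_mul_wsComplexity _).trans
        (Nat.mul_le_mul_left 4 (hd n)))
    exact Nat.add_le_add_right (Nat.mul_le_mul_left 3 h1) 1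
  · have h := HI16Skew.isProjection_detPoly_of_isSkew (P n) (h2 n) (hsk n)
    have he : (P n).eval = f n := hcomp n
    rwa [he] at h

/-- **`(IMM_{n,n}) ∈ VBP = VP_ws`** — the survey's square family `n ↦ immPoly n n k`
(Bürgisser 2024, Rem. 2.8(2) / Cor. 2.24, membership half; from `IMMSkew.wsComplexity_immPoly_le`,
cf. `isVPwsFamily_immPoly` for the families `n ↦ IMM_{n^c, n}`).
[cite: Burgisser2024Completeness, Cor. 2.24] -/
theorem isVPwsFamily_immPoly_sq (k : Type u) [CommRing k] :
    IsVPwsFamily fun n => immPoly n n k := by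
  have hid : IsPBounded fun n : ℕ => n := IsPBounded.id
  have hB : IsPBounded fun n : ℕ =>
      n * (4 * ((n + 2) * (2 * ((n + 1) * n) + 3) ^ 2)) + (n + 1) :=
    IsPBounded.add_holds (IsPBounded.mul_holds hid (IsPBounded.mul_holds (IsPBounded.const 4)
      (IsPBounded.mul_holds (IsPBounded.add_holds hid (IsPBounded.const 2))
        (IsPBounded.pow_holds (IsPBounded.add_holds (IsPBounded.mul_holds (IsPBounded.const 2)
          (IsPBounded.mul_holds (IsPBounded.add_holds hid (IsPBounded.const 1)) hid))
          (IsPBounded.const 3)) 2))))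
      (IsPBounded.add_holds hid (IsPBounded.const 1))
  exact hB.mono fun n => IMMSkew.wsComplexity_immPoly_le k n n

/-- **Bürgisser 2024, Corollary 2.24: "The iterated matrix multiplication family `(IMM_{n,n})` is
`VBP`-complete over any field"** — for the tree's `immPoly n n k = tr(X^{(1)} ⋯ X^{(n)})`,
`VBP = VP_ws` (`IsVPwsFamily`) and p-projections (`IsPProjection`), over every commutative ring
`k`: (membership) `n ↦ IMM_{n,n}` is a `VP_ws` family, and (hardness) every `VP_ws` family, in
any variable types `σ n`, is a p-projection of it.
[cite: Burgisser2024Completeness, Cor. 2.24] -/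
theorem Bur24_cor_2_24 (k : Type u) [CommRing k] :
    IsVPwsFamily (fun n => immPoly n n k) ∧
      ∀ {σ : ℕ → Type v} (f : ∀ n, MvPolynomial (σ n) k), IsVPwsFamily f →
        IsPProjection f (fun n => immPoly n n k) :=
  ⟨isVPwsFamily_immPoly_sq k, fun _ hf => isPProjection_immPoly_of_isVPwsFamily hf⟩

/-- **`(DET_n)` is a p-projection of `(IMM_{n,n})`** (both are `VBP`-complete, Thm. 2.20 and
Cor. 2.24; from `HI16Skew.isVPwsFamily_detPoly`). [cite: Burgisser2024Completeness, Cor. 2.24] -/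
theorem isPProjection_detPoly_immPoly (k : Type u) [CommRing k] :
    IsPProjection (fun n => detPoly (Fin n) k) (fun n => immPoly n n k) :=
  isPProjection_immPoly_of_isVPwsFamily (HI16Skew.isVPwsFamily_detPoly k)

/-- **`(IMM_{n,n})` is a p-projection of `(DET_n)`** (both are `VBP`-complete, Thm. 2.20 and
Cor. 2.24; from `isVPwsFamily_immPoly_sq`). [cite: Burgisser2024Completeness, Thm. 2.20] -/
theorem isPProjection_immPoly_detPoly (k : Type u) [CommRing k] :
    IsPProjection (fun n => immPoly n n k) (fun n => detPoly (Fin n) k) :=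
  isPProjection_detPoly_of_isVPwsFamily (isVPwsFamily_immPoly_sq k)

/-- **`VBP = VP_ws` is the class of p-projections of the determinant** (Bürgisser 2024,
Thm. 2.20 with Prop. 2.17 and the closure of `VBP` under p-projections, §3.1; Malod–Portier 2008):
a family, in any variable types and over any commutative ring, is a `VP_ws` family iff it is a
p-projection of `(DET_n)` (`isPProjection_detPoly_of_isVPwsFamily`; conversely
`HI16Skew.isVPwsFamily_detPoly` and `IsVPwsFamily.of_isPProjection`).
[cite: Burgisser2024Completeness, Thm. 2.20] -/
theorem isVPwsFamily_iff_isPProjection_detPoly {σ : ℕ → Type v} {f : ∀ n, MvPolynomial (σ n) k} :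
    IsVPwsFamily f ↔ IsPProjection f (fun n => detPoly (Fin n) k) :=
  ⟨isPProjection_detPoly_of_isVPwsFamily,
    fun h => (HI16Skew.isVPwsFamily_detPoly k).of_isPProjection h⟩

/-- **`VBP = VP_ws` is the class of p-projections of `(IMM_{n,n})`** (Bürgisser 2024, Cor. 2.24
with the closure of `VBP` under p-projections, §3.1): a family, in any variable types and over
any commutative ring, is a `VP_ws` family iff it is a p-projection of `n ↦ immPoly n n k`
(`isPProjection_immPoly_of_isVPwsFamily`; conversely `isVPwsFamily_immPoly_sq` and
`IsVPwsFamily.of_isPProjection`). [cite: Burgisser2024Completeness, Cor. 2.24] -/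
theorem isVPwsFamily_iff_isPProjection_immPoly {σ : ℕ → Type v} {f : ∀ n, MvPolynomial (σ n) k} :
    IsVPwsFamily f ↔ IsPProjection f (fun n => immPoly n n k) :=
  ⟨isPProjection_immPoly_of_isVPwsFamily, fun h => (isVPwsFamily_immPoly_sq k).of_isPProjection h⟩

end Families

end Literature.Computability.AlgebraicComplexity
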